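import Mathlib
import HarnessLib.Audit
import Summits.PneNP.PneNP.Theorems.PstarQuadBias
import Summits.PneNP.PneNP.Theorems.PstarLagrangian
import Summits.PneNP.PneNP.Theorems.PstarCubeIdeals

/-!
# Bias and radical of a quadratic function on a finite `𝔽₂`-module: the tools of rank rigidity (ROUND-24, GAPTWO-PLAN v1 S4b/O4)

FRONTIER range-avoidance ladder, rung F-N3, ROUND 24 (cell `pnp-ideate`, planner memo `r24/CORE-BOUND-NOTES.md` §4 (R4) / §9 (O4
"rank rigidity"); restricted-model proof complexity — nothing here bears on `P` versus `NP`).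

For a quadratic function `f` on a finite `𝔽₂`-module `M` with polar form `B` (`PstarCubeIdeals.IsQuadFn`): its BIAS
`bias f = Σ_x χ(f x) ∈ ℤ` and the RADICAL `rad B = {x : B x · = 0}`.  Facts (sequel `PstarRankRigidity` uses them to prove that a
degree-`2` function vanishing on `Z(q)` is `0` or `q` when `q` has rank `≥ 6`, positive bias, or a translation direction):

* `polar_self`, `polar_symm` — the polar form is alternating and symmetric;
* `bias_sq_le_pow` — `bias(f)² ≤ 2^{dim M + dim rad B}` (`PstarQuadBias.bias_sq_le` at `D = ⊤`), so `|bias f| ≤ 2^{dim M − 1}` as soon as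
  `B ≠ 0` (`finrank_rad_add_two_le`: a non-zero alternating form has radical of codimension `≥ 2`; `two_mul_abs_bias_le`);
* `bias_eq_zero_of_affine` (non-constant affine functions are balanced), `bias_const`;
* `bias_add_card_eq` — if `g` vanishes on `Z(q)` then `g` and `q + g` have disjoint supports covering that of `q`:
  `bias q + |M| = bias g + bias (q + g)`;
* `finrank_rad_add_le` — radicals are subadditive: `dim rad B + dim rad B' ≤ dim M + dim rad (B + B')`;
* `cubic_obstruction` — if `q · m` is still quadratic for an affine non-constant `m` (linear part `ℓ`, `ℓ c = 1`), then
  `B x a = B x c · ℓ a + B a c · ℓ x`: the polar form of `q` has rank `≤ 2` (`finrank_rad_of_cubic`: `dim rad B ≥ dim M − 2`).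
-/

set_option linter.dupNamespace false -- `Summit.PneNP.PneNP.…`: summit = sub-problem name (D-0017 single-conjunct layout)

open Finset Module
open Summit.PneNP.PneNP.Theorems.PstarQuadBias (chi chi_zero chi_add chi_add_one chi_of_ne_zero sum_chi_eq_zero_of_shift bias_sq_le
  card_eq_two_pow_finrank)
open Summit.PneNP.PneNP.Theorems.PstarLagrangian (finrank_le_finrank_inf_ker_add_one)
open Summit.PneNP.PneNP.Theorems.PstarCubeIdeals (deriv IsAffineFn IsQuadFn deriv_apply flips_of_affine)

namespace Summit.PneNP.PneNP.Theorems.PstarQuadRank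

/-- Every element of `𝔽₂` is `0` or `1`. -/
private theorem zmod2_cases (t : ZMod 2) : t = 0 ∨ t = 1 := by
  revert t; decide

/-- In `𝔽₂`, `t ≠ 0 ↔ t = 1`. -/
private theorem zmod2_eq_one_of_ne_zero {t : ZMod 2} (h : t ≠ 0) : t = 1 := by
  revert t h; decide

/-- In `𝔽₂`, `x + x = 0`. -/
private theorem zmod2_add_self (x : ZMod 2) : x + x = 0 := by
  revert x; decide

variable {M : Type*} [AddCommGroup M] [Module (ZMod 2) M]

/-- In an `𝔽₂`-module, `u + u = 0`. -/
private theorem add_self_eq_zero (u : M) : u + u = 0 := by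
  rw [← two_smul (ZMod 2) u, show (2 : ZMod 2) = 0 from rfl, zero_smul]

/-! ## The polar form of a quadratic function -/

section Polar

variable {f : M → ZMod 2} {B : LinearMap.BilinForm (ZMod 2) M} (hB : ∀ x w, f (x + w) = f x + f w + f 0 + B x w)
include hB

/-- The polar form is alternating. -/
theorem polar_self (x : M) : B x x = 0 := by
  have h := hB x x
  rw [add_self_eq_zero] at h
  have h2 := zmod2_add_self (f x)
  linear_combination -h - h2

/-- The polar form is symmetric. -/
theorem polar_symm (x w : M) : B x w = B w x := by
  have h1 := hB x w
  have h2 := hB w x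
  rw [add_comm w x] at h2
  linear_combination -h1 + h2

/-- A constant function has polar form `0`. -/
theorem polar_eq_zero_of_const (hc : ∀ x, f x = f 0) : ∀ x w, B x w = 0 := by
  intro x w
  have h := hB x w
  rw [hc (x + w), hc x, hc w] at h
  have h2 := zmod2_add_self (f 0)
  linear_combination -h - h2

/-- With polar form `0` the function is affine. -/
theorem isAffineFn_of_polar_zero (h0 : ∀ x w, B x w = 0) : IsAffineFn f := by
  intro x w; rw [hB, h0, add_zero]

/-- The derivative along `v`: `∂_v f (x) = f v + f 0 + B x v`. -/
theorem deriv_eq (v x : M) : deriv f v x = f v + f 0 + B x v := by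
  rw [deriv_apply, hB]
  have := zmod2_add_self (f x)
  linear_combination this

end Polar

/-! ## The radical -/

/-- The radical of a bilinear form: vectors pairing to `0` with everything (left radical; = right radical for symmetric forms). -/
def rad (B : LinearMap.BilinForm (ZMod 2) M) : Submodule (ZMod 2) M := LinearMap.ker B

/-- Membership in the radical. -/
theorem mem_rad {B : LinearMap.BilinForm (ZMod 2) M} {x : M} : x ∈ rad B ↔ ∀ y, B x y = 0 := by
  unfold rad
  rw [LinearMap.mem_ker, LinearMap.ext_iff]
  rfl

/-- **Radicals are subadditive**: `rad B ⊓ rad B' ≤ rad (B + B')`. -/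
theorem rad_inf_le (B B' : LinearMap.BilinForm (ZMod 2) M) : rad B ⊓ rad B' ≤ rad (B + B') := by
  intro x hx
  rw [Submodule.mem_inf] at hx
  rw [mem_rad]
  intro y
  rw [LinearMap.add_apply, LinearMap.add_apply, mem_rad.1 hx.1 y, mem_rad.1 hx.2 y, add_zero]

section Finite

variable [Fintype M] [DecidableEq M]

/-- The bias `Σ_x χ(f x)` of a function. -/
def bias (f : M → ZMod 2) : ℤ := ∑ x, chi (f x)

omit [DecidableEq M] in
/-- `|M| = 2 ^ dim M`. -/
theorem card_eq_pow : (Fintype.card M : ℤ) = 2 ^ finrank (ZMod 2) M := by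
  have h := card_eq_two_pow_finrank (⊤ : Submodule (ZMod 2) M) (univ : Finset M) (fun x => by simp)
  rw [finrank_top, Finset.card_univ] at h
  exact_mod_cast h

omit [Fintype M] [DecidableEq M] in
/-- Dimension subadditivity of radicals: `dim rad B + dim rad B' ≤ dim M + dim rad (B + B')`. -/
theorem finrank_rad_add_le [FiniteDimensional (ZMod 2) M] (B B' : LinearMap.BilinForm (ZMod 2) M) :
    finrank (ZMod 2) (rad B) + finrank (ZMod 2) (rad B') ≤ finrank (ZMod 2) M + finrank (ZMod 2) (rad (B + B')) := by
  have h1 := Submodule.finrank_sup_add_finrank_inf_eq (rad B) (rad B')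
  have h2 : finrank (ZMod 2) ↥(rad B ⊔ rad B') ≤ finrank (ZMod 2) M := Submodule.finrank_le _
  have h3 : finrank (ZMod 2) ↥(rad B ⊓ rad B') ≤ finrank (ZMod 2) (rad (B + B')) := Submodule.finrank_mono (rad_inf_le B B')
  omega

omit [Fintype M] [DecidableEq M] in
/-- **A non-zero alternating symmetric form has radical of codimension at least `2`.** -/
theorem finrank_rad_add_two_le [FiniteDimensional (ZMod 2) M] {B : LinearMap.BilinForm (ZMod 2) M} (halt : ∀ x, B x x = 0) (hsymm : ∀ x y, B x y = B y x)
    {a b : M} (hab : B a b ≠ 0) : finrank (ZMod 2) (rad B) + 2 ≤ finrank (ZMod 2) M := by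
  classical
  -- the functionals `B a` and `B b` are independent modulo the annihilator: `a, b, a+b ∉ rad`, and `rad ⊓ ker (B a) ⊓ ker (B b)`…
  -- we bound the radical inside the kernel of `B · b`, then inside the kernel of `B · a`, each a proper cut.
  have hba : B b a ≠ 0 := by rwa [hsymm] at hab
  -- `rad B ≤ ker (B.flip b)`-style cuts: use the chain `rad B < rad B ⊔ span{a} < rad B ⊔ span{a,b} ≤ M`
  have h1 : a ∉ rad B := fun h => hab (mem_rad.1 h b)
  have h2 : b ∉ rad B ⊔ (ZMod 2) ∙ a := by
    intro h
    rw [Submodule.mem_sup] at h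
    obtain ⟨r, hr, s, hs, hrs⟩ := h
    rw [Submodule.mem_span_singleton] at hs
    obtain ⟨t, rfl⟩ := hs
    -- pair with `a`: `B b a = B r a + t • B a a = 0`
    have e : B b a = B r a + t • B a a := by rw [← hrs, map_add, map_smul, LinearMap.add_apply, LinearMap.smul_apply]
    rw [mem_rad.1 hr a, halt a, smul_zero, add_zero] at e
    exact hba e
  have lt1 : rad B < rad B ⊔ (ZMod 2) ∙ a := by
    refine lt_of_le_of_ne le_sup_left fun h => h1 ?_
    rw [h]; exact Submodule.mem_sup_right (Submodule.mem_span_singleton_self a)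
  have lt2 : rad B ⊔ (ZMod 2) ∙ a < (rad B ⊔ (ZMod 2) ∙ a) ⊔ (ZMod 2) ∙ b := by
    refine lt_of_le_of_ne le_sup_left fun h => h2 ?_
    rw [h]; exact Submodule.mem_sup_right (Submodule.mem_span_singleton_self b)
  have d1 := Submodule.finrank_lt_finrank_of_lt lt1
  have d2 := Submodule.finrank_lt_finrank_of_lt lt2
  have d3 : finrank (ZMod 2) ↥((rad B ⊔ (ZMod 2) ∙ a) ⊔ (ZMod 2) ∙ b) ≤ finrank (ZMod 2) M := Submodule.finrank_le _
  omega

/-! ## Bias bounds -/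

/-- **`bias(f)² ≤ 2^{dim M + dim rad B}`** for a quadratic `f` with polar form `B`. -/
theorem bias_sq_le_pow {f : M → ZMod 2} {B : LinearMap.BilinForm (ZMod 2) M} (hB : ∀ x w, f (x + w) = f x + f w + f 0 + B x w) :
    bias f ^ 2 ≤ 2 ^ (finrank (ZMod 2) M + finrank (ZMod 2) (rad B)) := by
  classical
  have hf : ∀ x w, f (x + w) = f x + f w - f 0 + B x w := by
    intro x w; rw [hB, sub_eq_add_neg, ZMod.neg_eq_self_mod_two]
  set ℛ : Finset M := univ.filter fun x => x ∈ rad B with hℛdef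
  have hℛ : ∀ x, x ∈ ℛ ↔ x ∈ (⊤ : Submodule (ZMod 2) M) ∧ ∀ n ∈ (⊤ : Submodule (ZMod 2) M), B n x = 0 := by
    intro x
    rw [hℛdef, mem_filter, mem_rad]
    simp only [mem_univ, true_and, Submodule.mem_top, forall_const]
    exact ⟨fun h n => by rw [polar_symm hB]; exact h n, fun h y => by rw [polar_symm hB]; exact h y⟩
  have hℛcard : (ℛ.card : ℤ) = 2 ^ finrank (ZMod 2) (rad B) := by
    exact_mod_cast card_eq_two_pow_finrank (rad B) ℛ (fun x => by rw [hℛdef, mem_filter]; simp)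
  have h := bias_sq_le B f hf ⊤ univ ℛ (fun x => by simp) hℛ 0
  simp only [zero_add] at h
  unfold bias
  rw [pow_add, ← card_eq_pow, ← hℛcard, ← Finset.card_univ]
  exact h

/-- Hence **`2·|bias f| ≤ |M|` when the polar form is not zero**. -/
theorem two_mul_abs_bias_le {f : M → ZMod 2} {B : LinearMap.BilinForm (ZMod 2) M} (hB : ∀ x w, f (x + w) = f x + f w + f 0 + B x w)
    {a b : M} (hab : B a b ≠ 0) : 2 * |bias f| ≤ 2 ^ finrank (ZMod 2) M := by
  have h1 := bias_sq_le_pow hB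
  have h2 := finrank_rad_add_two_le (polar_self hB) (polar_symm hB) hab
  have h3 : (2 : ℤ) ^ (finrank (ZMod 2) M + finrank (ZMod 2) (rad B) + 2) ≤ 2 ^ (finrank (ZMod 2) M + finrank (ZMod 2) M) :=
    pow_le_pow_right₀ (by norm_num) (by omega)
  have h4 : (2 * |bias f|) ^ 2 ≤ (2 ^ finrank (ZMod 2) M) ^ 2 := by
    have e1 : (2 * |bias f|) ^ 2 = bias f ^ 2 * 2 ^ 2 := by rw [mul_pow, sq_abs]; ring
    have e2 : (2 : ℤ) ^ (finrank (ZMod 2) M + finrank (ZMod 2) (rad B) + 2) =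
        2 ^ (finrank (ZMod 2) M + finrank (ZMod 2) (rad B)) * 2 ^ 2 := by rw [pow_add]
    have e3 : (2 : ℤ) ^ (finrank (ZMod 2) M + finrank (ZMod 2) M) = (2 ^ finrank (ZMod 2) M) ^ 2 := by rw [sq, pow_add]
    rw [e1, ← e3]
    rw [e2] at h3
    have h5 : (0 : ℤ) ≤ 2 ^ 2 := by positivity
    nlinarith
  exact (pow_le_pow_iff_left₀ (by positivity) (by positivity) two_ne_zero).1 h4

/-- A non-constant affine function is balanced: `bias = 0`. -/
theorem bias_eq_zero_of_affine {m : M → ZMod 2} (hm : IsAffineFn m) {v : M} (hv : m v ≠ m 0) : bias m = 0 := by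
  unfold bias
  exact sum_chi_eq_zero_of_shift univ v (fun _ _ => mem_univ _) m fun x _ => flips_of_affine hm hv x

omit [DecidableEq M] in
/-- The bias of a constant. -/
theorem bias_const (c : ZMod 2) : bias (fun _ : M => c) = chi c * 2 ^ finrank (ZMod 2) M := by
  unfold bias
  rw [sum_const, nsmul_eq_mul, Finset.card_univ, card_eq_pow, mul_comm]

omit [DecidableEq M] in
/-- `|bias f| ≤ |M|` always. -/
theorem abs_bias_le (f : M → ZMod 2) : |bias f| ≤ 2 ^ finrank (ZMod 2) M := by
  unfold bias
  rw [← card_eq_pow, ← Finset.card_univ]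
  refine (abs_sum_le_sum_abs _ _).trans ?_
  have : ∀ x ∈ (univ : Finset M), |chi (f x)| ≤ 1 := fun x _ => by unfold chi; split_ifs <;> simp
  calc ∑ x, |chi (f x)| ≤ ∑ _x : M, (1 : ℤ) := sum_le_sum this
    _ = (univ : Finset M).card := by simp

/-! ## Disjoint supports -/

omit [DecidableEq M] in
/-- **Support splitting.**  If `g` vanishes on `Z(q)` then `χ(q) + 1 = χ(g) + χ(q + g)` pointwise, hence
`bias q + |M| = bias g + bias (q + g)`. -/
theorem bias_add_card_eq {q g : M → ZMod 2} (hZ : ∀ x, q x = 0 → g x = 0) :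
    bias q + 2 ^ finrank (ZMod 2) M = bias g + bias (fun x => q x + g x) := by
  unfold bias
  rw [← card_eq_pow, ← Finset.card_univ, show ((univ : Finset M).card : ℤ) = ∑ _x : M, (1 : ℤ) by simp, ← sum_add_distrib,
    ← sum_add_distrib]
  refine sum_congr rfl fun x _ => ?_
  dsimp only
  rcases zmod2_cases (q x) with hq | hq
  · rw [hZ x hq, hq]; decide
  · rcases zmod2_cases (g x) with hg | hg <;> rw [hq, hg] <;> decide

/-! ## The cubic obstruction -/

omit [Fintype M] [DecidableEq M] in
/-- **Cubic obstruction.**  If `q` is quadratic with polar form `B`, `m` is affine, and the product `q · m` is still quadratic, then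
for all `x, a, b`: `B x a · ℓ b + B x b · ℓ a + B a b · ℓ x = 0` where `ℓ = m + m 0` is the linear part of `m` (the cubic term of `q·m`
vanishes). -/
theorem cubic_obstruction {q m : M → ZMod 2} {B : LinearMap.BilinForm (ZMod 2) M} (hB : ∀ x w, q (x + w) = q x + q w + q 0 + B x w)
    (hm : IsAffineFn m) (hqm : IsQuadFn (fun x => q x * m x)) (x a b : M) :
    B x a * (m b + m 0) + B x b * (m a + m 0) + B a b * (m x + m 0) = 0 := by
  obtain ⟨C, hC⟩ := hqm
  -- second difference of a quadratic is constant: `F(x+a+b) + F(x+a) + F(x+b) + F(x) = C a b`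
  have hDD : ∀ F : M → ZMod 2, ∀ C' : LinearMap.BilinForm (ZMod 2) M, (∀ x w, F (x + w) = F x + F w + F 0 + C' x w) →
      ∀ x, F (x + a + b) + F (x + a) + F (x + b) + F x = C' a b := by
    intro F C' hF x
    rw [hF (x + a) b, hF x a, hF x b]
    have e1 : (C' (x + a)) b = (C' x) b + (C' a) b := by rw [map_add, LinearMap.add_apply]
    -- need `C' x b + C' x b = 0` etc.
    have d1 := zmod2_add_self (F x)
    have d2 := zmod2_add_self (F a)
    have d3 := zmod2_add_self (F b)
    have d4 := zmod2_add_self (F 0)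
    have d5 := zmod2_add_self ((C' x) a)
    have d6 := zmod2_add_self ((C' x) b)
    linear_combination e1 + d1 + d3 + d4 + d6 + d1 + d2 + d4 + d5
  have key := hDD (fun x => q x * m x) C hC
  have k1 := key x
  have k0 := key 0
  simp only [zero_add] at k1 k0
  -- expand `q` and `m` at the shifted points
  have qa : q (x + a) = q x + q a + q 0 + B x a := hB x a
  have qb : q (x + b) = q x + q b + q 0 + B x b := hB x b
  have qab : q (x + a + b) = q x + q a + q b + q 0 + q 0 + B x a + B x b + B a b := by
    rw [hB (x + a) b, hB x a, map_add, LinearMap.add_apply]; ring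
  have ma : m (x + a) = m x + m a + m 0 := hm x a
  have mb : m (x + b) = m x + m b + m 0 := hm x b
  have mab : m (x + a + b) = m x + m a + m b + m 0 + m 0 := by rw [hm (x + a) b, hm x a]; ring
  have qab0 : q (a + b) = q a + q b + q 0 + B a b := hB a b
  have mab0 : m (a + b) = m a + m b + m 0 := hm a b
  rw [qab, qa, qb, mab, ma, mb] at k1
  rw [qab0, mab0] at k0
  -- in `𝔽₂` every value is idempotent: reduce with `t * t = t` facts and conclude by brute force on the finitely many atoms
  have i1 : ∀ t : ZMod 2, t * t = t := by decide
  generalize q x = Q at k1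
  generalize q a = Qa at k1 k0
  generalize q b = Qb at k1 k0
  generalize q 0 = Q0 at k1 k0
  generalize m x = Mx at k1 ⊢
  generalize m a = Ma at k1 k0 ⊢
  generalize m b = Mb at k1 k0 ⊢
  generalize m 0 = M0 at k1 k0 ⊢
  generalize (B x) a = Bxa at k1 ⊢
  generalize (B x) b = Bxb at k1 ⊢
  generalize (B a) b = Bab at k1 k0 ⊢
  generalize (C a) b = Cab at k1 k0
  revert Q Qa Qb Q0 Mx Ma Mb M0 Bxa Bxb Bab Cab
  decide

omit [Fintype M] [DecidableEq M] in
/-- **Rank at most two from the cubic obstruction**: with `ℓ c = 1`, `B x a = B x c · ℓ a + B a c · ℓ x`. -/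
theorem polar_eq_of_cubic {q m : M → ZMod 2} {B : LinearMap.BilinForm (ZMod 2) M} (hB : ∀ x w, q (x + w) = q x + q w + q 0 + B x w)
    (hm : IsAffineFn m) (hqm : IsQuadFn (fun x => q x * m x)) {c : M} (hc : m c + m 0 = 1) (x a : M) :
    B x a = B x c * (m a + m 0) + B a c * (m x + m 0) := by
  have h := cubic_obstruction hB hm hqm x a c
  rw [hc, mul_one] at h
  linear_combination h - zmod2_add_self (B x c * (m a + m 0) + B a c * (m x + m 0))

omit [Fintype M] [DecidableEq M] in
/-- Hence the radical contains `ker ℓ ∩ ker B(·, c)`: **`dim rad B + 2 ≥ dim M`** — the polar form has rank at most `2`. -/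
theorem finrank_le_rad_add_two_of_cubic [FiniteDimensional (ZMod 2) M] {q m : M → ZMod 2} {B : LinearMap.BilinForm (ZMod 2) M}
    (hB : ∀ x w, q (x + w) = q x + q w + q 0 + B x w) (hm : IsAffineFn m) (hqm : IsQuadFn (fun x => q x * m x)) {c : M}
    (hc : m c + m 0 = 1) : finrank (ZMod 2) M ≤ finrank (ZMod 2) (rad B) + 2 := by
  -- the linear part of `m` as a linear map
  have hlin : ∀ x w, m (x + w) + m 0 = (m x + m 0) + (m w + m 0) := by
    intro x w; rw [hm]; ring
  let ℓ : M →ₗ[ZMod 2] ZMod 2 :=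
    { toFun := fun x => m x + m 0
      map_add' := hlin
      map_smul' := by
        intro t x
        rcases zmod2_cases t with rfl | rfl
        · rw [zero_smul, RingHom.id_apply, zero_smul]; exact zmod2_add_self _
        · rw [one_smul, RingHom.id_apply, one_smul] }
  have hℓ : ∀ x, ℓ x = m x + m 0 := fun _ => rfl
  -- `ker ℓ ⊓ ker (B c) ≤ rad B`
  have hsub : (⊤ ⊓ LinearMap.ker ℓ) ⊓ LinearMap.ker (B c) ≤ rad B := by
    intro x hx
    simp only [Submodule.mem_inf, Submodule.mem_top, true_and, LinearMap.mem_ker] at hx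
    rw [hℓ] at hx
    rw [mem_rad]
    intro y
    rw [polar_eq_of_cubic hB hm hqm hc x y, polar_symm hB x c, hx.2, hx.1, zero_mul, mul_zero, add_zero]
  have h1 := finrank_le_finrank_inf_ker_add_one (⊤ : Submodule (ZMod 2) M) ℓ
  have h2 := finrank_le_finrank_inf_ker_add_one (⊤ ⊓ LinearMap.ker ℓ) (B c)
  have h3 := Submodule.finrank_mono hsub
  rw [finrank_top] at h1
  omega

end Finite

end Summit.PneNP.PneNP.Theorems.PstarQuadRank
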